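import Summits.QuantumAdvantage.QuantumAdvantage.Theorems.WalkTwoStepSparsePinnedFibre

/-!
# (G♯) local engine — `SparsePinned p` PROVED, part 2/3: §B the part on a glued fibre, §C non-effective cuts have status `false` on the part, the free-window pigeonhole

# (G♯) local engine — the sparse pinned branch `SparsePinned p` PROVED (every prime `p ≥ 5`)

Cell qa-qnc0, rung (G♯) = item stmt-QuantumAdvantage-23121 `OddPrimeWalk.TwoStepFreeRungFive` (planner qa-qnc0-p2 g24, ask P2-24b,
ROUND-24 §1ter REVISION (h) audit "TRUE as typed"); prover qn-prover-3 g15.  One of the three OPEN regime lemmas of the checked skeleton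
`WalkTwoStepLocalEngine{Core,Regimes,Glue}.lean` (`twoStepFreeRungFive_of : FarLocal 5 → SparsePinned 5 → DensePinned 5 → …`).

STATEMENT (`LocalEngine.SparsePinned p`, verbatim from the skeleton): for every `ε > 0` there is a window length `m` such that for every
two-step free-split strategy `S`, class `w`, pin datum `(d₀, u₀)` and charge `c`, if `(2·effOn + #pinTimes + 2p + 1)·m ≤ n` then the part
`Q = part S d₀ w u₀` satisfies `#winPart ≤ (2/3 + ε)·#Q`.

PROOF (port of rung (G)'s window branch `RungG.stub_sparse` / `fibre_bound`, with two additions).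
* §A two-step forms on a glued input `uA ++ v ++ uB` (`CleanGapStrategies.glue3`): a cut whose position and split both avoid the OPEN
  window has fire bit / live bit / status equal to explicit functions `fireR / liveR / statusR` of the window residue `r = wt v (mod 3p)`
  (`RungG.liftOf`, `RungG.stateOf`); passing to the lift `r + j·p` keeps `fireR` and twists the phase by `p` (cuts `≤ a`) or `2p`
  (cuts `> a`), so by `Coset21.twistedNotAllThree` the three lifts of a residue mod `p` do NOT all win (`not_winE_all_three`).
* §B the part on a fibre: with the window inside `[p, n − p)` and no pin time strictly inside it, membership of `uA ++ v ++ uB` in `Q`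
  depends on `v` only through `wt v (mod p)` (`mem_part_glue3_of_wt_eq`), so the fibre of `Q` is empty or a full residue class mod `p`.
* §C (new) cuts that are NOT effective on `Q` have status identically `false` on `Q`: a second, `g`-free window and the three lifts
  rotate the phase of `g` through all of `ℤ₃` inside `Q` (`exists_status_false`), so a constant status is the constant `false`.  (Without
  this the parity argument would only bound the effective cuts' contribution up to an unknown constant.)
* §D pigeonhole for a free window among `2·effOn + #pinTimes + 1` candidates inside `[p, n − p)`, the per-fibre bound (the arithmetic of
  `RungG.fibre_bound` verbatim, `RungG.stub_equidist` at modulus `3p`), Fubini `card_filter_eq_sum_glue3`; `sparsePinned_of_prime`,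
  `sparsePinned_five : SparsePinned 5`.

WHAT THIS IS NOT: `FarLocal` and `DensePinned` stay open (so (G♯) is not yet proved); nothing about `LinSel`/R5; separation NOT moved.

This file: §B, §C and the pigeonhole of §D.  Part 3/3: `WalkTwoStepSparsePinned.lean`.
-/

namespace Summit.QuantumAdvantage.AdviceFreeQNC0.LocalEngine
open Finset Classical
open Summit.QuantumAdvantage.AdviceFreeQNC0.Coset21 (twistedNotAllThree)
open Summit.QuantumAdvantage.AdviceFreeQNC0.Coset21.RungG (classOf proj proj_natCast liftOf stateOf liftOf_glue3
  stateOf_glue3 cast3_val_add_nat exists_lift_eq proj_lift Equidist stub_equidist mod_three_of_mod)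

/-! ### §B Glued inputs: coordinates, and the part `Q` on a fibre -/

section Glue

variable {p : ℕ} {a m q : ℕ}

/-- Coordinates before the window read the prefix block. -/
theorem glue3_apply_castAdd_castAdd (uA : Fin a → Bool) (v : Fin m → Bool) (uB : Fin q → Bool) (i : Fin a) :
    glue3 uA v uB (Fin.castAdd q (Fin.castAdd m i)) = uA i := by
  unfold glue3; rw [Fin.append_left, Fin.append_left]

/-- Coordinates after the window read the suffix block. -/
theorem glue3_apply_natAdd (uA : Fin a → Bool) (v : Fin m → Bool) (uB : Fin q → Bool) (i : Fin q) :
    glue3 uA v uB (Fin.natAdd (a + m) i) = uB i := by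
  unfold glue3; rw [Fin.append_right]

/-- Coordinates outside the window do not read the window block. -/
theorem glue3_apply_eq_of_not_mem_window (uA : Fin a → Bool) (v v' : Fin m → Bool) (uB : Fin q → Bool) (i : Fin (a + m + q))
    (h : i.val < a ∨ a + m ≤ i.val) : glue3 uA v uB i = glue3 uA v' uB i := by
  rcases h with h | h
  · have e : i = Fin.castAdd q (Fin.castAdd m ⟨i.val, h⟩) := Fin.ext rfl
    rw [e, glue3_apply_castAdd_castAdd, glue3_apply_castAdd_castAdd]
  · have e : i = Fin.natAdd (a + m) ⟨i.val - (a + m), by omega⟩ := Fin.ext (by simp only [Fin.natAdd_mk]; omega)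
    rw [e, glue3_apply_natAdd, glue3_apply_natAdd]

/-- Every input is a glued input. -/
theorem exists_eq_glue3 (u : Fin (a + m + q) → Bool) : ∃ (uA : Fin a → Bool) (v : Fin m → Bool) (uB : Fin q → Bool),
    u = glue3 uA v uB := by
  refine ⟨fun i => u (Fin.castAdd q (Fin.castAdd m i)), fun i => u (Fin.castAdd q (Fin.natAdd a i)),
    fun i => u (Fin.natAdd (a + m) i), ?_⟩
  unfold glue3
  conv_lhs => rw [← Fin.append_castAdd_natAdd (f := u)]
  congr 1
  exact (Fin.append_castAdd_natAdd (f := fun i => u (Fin.castAdd q i))).symm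

/-- The indicator of the first `t` coordinates has weight `t` (for `t ≤ m`). -/
theorem wt_indicator_lt {t : ℕ} (ht : t ≤ m) : wt (fun i : Fin m => decide (i.val < t)) = t := by
  unfold wt
  dsimp only
  have h1 : ((univ : Finset (Fin m)).filter fun i : Fin m => decide (i.val < t) = true).image (fun i : Fin m => i.val)
      = Finset.range t := by
    ext x
    simp only [Finset.mem_image, Finset.mem_filter, Finset.mem_univ, true_and, decide_eq_true_eq, Finset.mem_range]
    constructor
    · rintro ⟨i, hi, rfl⟩; exact hi
    · intro hx; exact ⟨⟨x, by omega⟩, hx, rfl⟩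
  calc ((univ : Finset (Fin m)).filter fun i : Fin m => decide (i.val < t) = true).card
      = (((univ : Finset (Fin m)).filter fun i : Fin m => decide (i.val < t) = true).image (fun i : Fin m => i.val)).card :=
        (Finset.card_image_of_injective _ Fin.val_injective).symm
    _ = (Finset.range t).card := by rw [h1]
    _ = t := Finset.card_range t

variable (S : TwoStep p (a + m + q)) (d₀ : ℕ) (w : ZMod p) (u₀ : Fin (a + m + q) → Bool)

/-- **The part on a fibre**: with the window inside `[p, n − p)` and no pin time strictly inside it, membership of `uA ++ v ++ uB`
in the part depends on `v` only through `wt v (mod p)`. -/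
theorem mem_part_glue3_of_wt_eq (hpa : p ≤ a) (hpq : p ≤ q)
    (hpins : ∀ τ ∈ pinTimes S d₀, τ.val ≤ a ∨ a + m ≤ τ.val)
    (uA : Fin a → Bool) (uB : Fin q → Bool) (v v' : Fin m → Bool)
    (hvv : ((wt v : ℕ) : ZMod p) = ((wt v' : ℕ) : ZMod p)) (hv : glue3 uA v uB ∈ part S d₀ w u₀) :
    glue3 uA v' uB ∈ part S d₀ w u₀ := by
  unfold part at hv ⊢
  rw [Finset.mem_filter] at hv ⊢
  obtain ⟨hcl, hkey⟩ := hv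
  refine ⟨?_, ?_⟩
  · unfold Coset21.RungG.classOf at hcl ⊢
    rw [Finset.mem_filter] at hcl ⊢
    refine ⟨Finset.mem_univ _, ?_⟩
    rw [← hcl.2, wt_glue3, wt_glue3]
    push_cast
    rw [hvv]
  · rw [← hkey]
    unfold pinKey
    refine Prod.ext ?_ ?_
    · funext τ
      by_cases hτ : τ ∈ pinTimes S d₀
      · simp only [if_pos hτ]
        rcases hpins τ hτ with h | h
        · rw [wtPrefix_glue3_of_le _ _ _ h, wtPrefix_glue3_of_le _ _ _ h]
        · rw [wtPrefix_glue3_of_ge _ _ _ h, wtPrefix_glue3_of_ge _ _ _ h]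
          push_cast
          rw [hvv]
      · simp only [if_neg hτ]
    · funext i
      by_cases hi : i ∈ bdry p (a + m + q)
      · simp only [if_pos hi]
        unfold bdry at hi
        rw [Finset.mem_filter] at hi
        exact glue3_apply_eq_of_not_mem_window uA v' v uB i (by rcases hi.2 with h | h <;> omega)
      · simp only [if_neg hi]

/-- On the part, the window weight has the residue `w − |uA| − |uB| (mod p)`. -/
theorem wt_window_eq_of_mem_part (uA : Fin a → Bool) (uB : Fin q → Bool) (v : Fin m → Bool)
    (hv : glue3 uA v uB ∈ part S d₀ w u₀) :
    ((wt v : ℕ) : ZMod p) = w - ((wt uA : ℕ) : ZMod p) - ((wt uB : ℕ) : ZMod p) := by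
  unfold part Coset21.RungG.classOf at hv
  rw [Finset.mem_filter, Finset.mem_filter] at hv
  have h := hv.1.2
  rw [wt_glue3] at h
  push_cast at h
  rw [← h]; ring

end Glue

/-! ### §C Non-effective cuts have status identically `false` on the part -/

section NonEff

variable {p : ℕ}

/-- Among `A, A + d, A + 2d` one is divisible by `3` when `3 ∤ d`. -/
theorem exists_add_mul_mod_three_eq_zero (A d : ℕ) (hd : ¬ 3 ∣ d) : ∃ j : ℕ, j < 3 ∧ (A + j * d) % 3 = 0 := by
  have hd' : d % 3 = 1 ∨ d % 3 = 2 := by omega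
  have hA : A % 3 = 0 ∨ A % 3 = 1 ∨ A % 3 = 2 := by omega
  rcases hd' with hd1 | hd2
  · rcases hA with h | h | h
    · exact ⟨0, by omega, by omega⟩
    · exact ⟨2, by omega, by omega⟩
    · exact ⟨1, by omega, by omega⟩
  · rcases hA with h | h | h
    · exact ⟨0, by omega, by omega⟩
    · exact ⟨1, by omega, by omega⟩
    · exact ⟨2, by omega, by omega⟩

/-- **A `g`-free admissible window kills the status of `g` somewhere on the part.**  If the part is nonempty and a window
`[b, b + m₂)` with `m₂ ≥ 3p`, inside `[p, n − p)`, with no pin time and not the position `g` strictly inside, exists, then some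
input of the part has `status g = false` (one of the three lifts of the window weight makes `g` dead). -/
theorem exists_status_false [Fact p.Prime] (hp3 : ¬ 3 ∣ p) {n : ℕ} (c d₀ : ℕ) (S : TwoStep p n) (w : ZMod p)
    (u₀ : Fin n → Bool) (g : Fin (n + 1)) (b m₂ : ℕ) (hm₂ : 3 * p ≤ m₂) (hpb : p ≤ b) (hbn : b + m₂ + p ≤ n)
    (hpins : ∀ τ ∈ pinTimes S d₀, τ.val ≤ b ∨ b + m₂ ≤ τ.val) (hg : g.val ≤ b ∨ b + m₂ ≤ g.val)
    (hQ : (part S d₀ w u₀).Nonempty) :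
    ∃ u ∈ part S d₀ w u₀, status c S g u = false := by
  have hp_pos : 0 < p := (Fact.out : p.Prime).pos
  obtain ⟨q', hq'⟩ : ∃ q', n = b + m₂ + q' := ⟨n - (b + m₂), by omega⟩
  subst hq'
  have hpq' : p ≤ q' := by omega
  obtain ⟨u₁, hu₁⟩ := hQ
  obtain ⟨uA, v₁, uB, rfl⟩ := exists_eq_glue3 u₁
  -- the three lifts of the window weight
  set k₁ := wt v₁ % p with hk₁
  have hk₁p : k₁ < p := Nat.mod_lt _ hp_pos
  set vj : ℕ → (Fin m₂ → Bool) := fun j => fun i => decide (i.val < k₁ + j * p) with hvj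
  have hwt : ∀ j, j < 3 → wt (vj j) = k₁ + j * p := by
    intro j hj
    apply wt_indicator_lt
    have : j * p ≤ 2 * p := Nat.mul_le_mul_right p (by omega)
    omega
  have hmem : ∀ j, j < 3 → glue3 uA (vj j) uB ∈ part S d₀ w u₀ := by
    intro j hj
    refine mem_part_glue3_of_wt_eq S d₀ w u₀ hpb hpq' hpins uA uB v₁ (vj j) ?_ hu₁
    rw [hwt j hj, Nat.cast_add, Nat.cast_mul, ZMod.natCast_self, mul_zero, add_zero, hk₁, ZMod.natCast_mod]
  -- the phase of `g` along the lifts: `A + j·(p·e)` with `e ∈ {1, 2}`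
  have hphase : ∃ A e : ℕ, ¬ 3 ∣ e ∧ ∀ j, j < 3 →
      c + g.val + walkExp (glue3 uA (vj j) uB) g.val = A + j * e := by
    rcases hg with hg | hg
    · refine ⟨c + g.val + (wt uA + k₁ + wt uB) + wtPrefix uA g.val, p, hp3, fun j hj => ?_⟩
      unfold walkExp
      rw [wt_glue3, wtPrefix_glue3_of_le _ _ _ hg, hwt j hj]
      ring
    · refine ⟨c + g.val + (wt uA + k₁ + wt uB) + (wt uA + k₁ + wtPrefix uB (g.val - (b + m₂))), 2 * p, by omega,
        fun j hj => ?_⟩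
      unfold walkExp
      rw [wt_glue3, wtPrefix_glue3_of_ge _ _ _ hg, hwt j hj]
      ring
  obtain ⟨A, e, he, hAe⟩ := hphase
  obtain ⟨j, hj, hj0⟩ := exists_add_mul_mod_three_eq_zero A e he
  refine ⟨glue3 uA (vj j) uB, hmem j hj, ?_⟩
  unfold status
  rw [hAe j hj, hj0]
  simp

/-- Hence a cut that is NOT effective on a nonempty part (with a `g`-free admissible window) has status `false` on all of it. -/
theorem status_eq_false_of_not_eff [Fact p.Prime] (hp3 : ¬ 3 ∣ p) {n : ℕ} (c d₀ : ℕ) (S : TwoStep p n) (w : ZMod p)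
    (u₀ : Fin n → Bool) (g : Fin (n + 1)) (b m₂ : ℕ) (hm₂ : 3 * p ≤ m₂) (hpb : p ≤ b) (hbn : b + m₂ + p ≤ n)
    (hpins : ∀ τ ∈ pinTimes S d₀, τ.val ≤ b ∨ b + m₂ ≤ τ.val) (hg : g.val ≤ b ∨ b + m₂ ≤ g.val)
    (hne : ¬ ∃ u ∈ part S d₀ w u₀, ∃ v ∈ part S d₀ w u₀, status c S g u ≠ status c S g v) :
    ∀ u ∈ part S d₀ w u₀, status c S g u = false := by
  intro u hu
  obtain ⟨u', hu', hfalse⟩ := exists_status_false hp3 c d₀ S w u₀ g b m₂ hm₂ hpb hbn hpins hg ⟨u, hu⟩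
  by_contra hcon
  exact hne ⟨u, hu, u', hu', by rw [hfalse]; exact hcon⟩

end NonEff

/-! ### §D The free window, the per-fibre bound, and `SparsePinned p` -/

section Main

variable {p : ℕ} {M : ℕ}

/-- Pigeonhole: among `J` consecutive windows of length `m ≥ 1` starting at `lo`, one has no obstacle of a set of `< J` obstacles
strictly inside. -/
theorem exists_window_avoiding (O : Finset ℕ) {lo m J : ℕ} (hm : 0 < m) (hJ : O.card < J) :
    ∃ j, j < J ∧ ∀ x ∈ O, ¬ (lo + j * m < x ∧ x < lo + j * m + m) := by
  set B := O.image fun x => (x - lo - 1) / m with hB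
  have hBcard : B.card < (Finset.range J).card := by
    rw [Finset.card_range]; exact lt_of_le_of_lt Finset.card_image_le hJ
  obtain ⟨j, hj, hjB⟩ := Finset.exists_mem_notMem_of_card_lt_card hBcard
  rw [Finset.mem_range] at hj
  refine ⟨j, hj, fun x hx hin => hjB ?_⟩
  rw [hB, Finset.mem_image]
  refine ⟨x, hx, ?_⟩
  exact Nat.div_eq_of_lt_le (by omega) (by rw [Nat.succ_mul]; omega)


end Main

end Summit.QuantumAdvantage.AdviceFreeQNC0.LocalEngine
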